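/- Free-seat work of WIDTH SEAT `ym-line-cbag-p1-w2` (prover-ym-line-cbag-p1-w2-g17-0), route `EguchiKawaiDirectionLadder`
(ideator ym-idea-2, LINE 8), crux `TripleSmallBallMargin` (stmt-QuantumFields-27724), LEAD g24's S10 CONTRACT piece S10-A in WINDOW
FORM: width seat w4's near/far compression split (`…CompressionSplit`) combined with the LEAD's ε-free general polar/defect lemma
(`…CompressionSplitGeneral`) and the LINEAR far-mass bound `Σ|S|² ≤ far mass` (instead of the quadratic `(far mass)²`) — the only
form that is `N`-uniform-usable when the far mass `≲ Nt/γ` is large.  Linear algebra only; ROUTE-INDEPENDENT.  Nothing here bears on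
the Yang–Mills mass gap (barrier-ledger line onto `EguchiKawaiBreakdown`). -/
import Summits.QuantumFields.YangMills.Theorems.EguchiKawaiDirectionLadderCompressionSplitGeneral
import Summits.QuantumFields.YangMills.Theorems.EguchiKawaiDirectionLadderCompressionSplit
import HarnessLib

/-!
# Route `EguchiKawaiDirectionLadder`, crux `TripleSmallBallMargin`: compression split with a linear far-mass bound (S10-A)

For a unitary `U ∈ U(N)` and a labelling `c : Fin N → Fin 3` (`0` = window `I`, `1` = near, `2` = far) the window
compression satisfies `1 − U_II U_II† = A₁A₁† + A₂A₂†` (`A₁ = U_{I,near}`, `A₂ = U_{I,far}`), and w4's general polar-defect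
lemma (the LEAD's ε-free form `exists_unitary_add_lowRank_add_small_general`) turns this into `U_II = Θ + R + S`, `Θ` unitary,
`rank R ≤ #near`, `Σ|S|² ≤ Σ|(A₂A₂†)_{ii'}|²`.  The point of this file is the LINEAR bound in WINDOW form

  `Σ_{i,i'∈I} |(A₂A₂†)_{ii'}|² ≤ Σ_{i∈I, j far} |U_{ij}|²`          (`blockGram_sum_norm_sq_le_farMass`),

i.e. `‖A₂A₂†‖_F² ≤ ‖A₂‖_op² ‖A₂‖_F² ≤ ‖A₂‖_F²` because a block of a unitary has operator norm `≤ 1`.  Proof with the tree's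
square-matrix Frobenius/operator-norm inequalities (`frobSq_mul_le'`): with the coordinate projections `Q = diag 𝟙_I`,
`P = diag 𝟙_far` and `B = Q·U·P`, `frobSq (B Bᴴ)` is the left side, `frobSq B` the right side, and `‖B‖_op ≤ 1`
(`Matrix.l2_opNorm_diagonal`, `CStarRing.norm_coe_unitary`).  Consequence:

  `compression_eq_unitary_add_lowRank_add_small_linear` — `U_II = Θ + R + S`, `rank R ≤ #{c = 1}`,
  `Σ|S|² ≤ Σ_{i∈I, c j = 2}|U_{ij}|²` for EVERY `U` (no invertibility, no `ε`).  (Complementary route to the LEAD's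
  `sum_norm_sq_le_re_trace_of_posSemidef_le_one`: here via `‖A₂‖_op ≤ 1`, there via `0 ≤ A₂A₂† ≤ 1`.)
-/

set_option autoImplicit false

noncomputable section

open scoped Matrix ComplexOrder Matrix.Norms.L2Operator
open Literature.Barriers.QuantumFields

namespace Summit.QuantumFields.YangMills.Theorems.EguchiKawaiDirectionLadder

variable {N : ℕ}

/-! ### Coordinate projections and the doubly projected link -/

/-- The coordinate projection `diag 𝟙_p` has operator norm `≤ 1`. -/
theorem l2_opNorm_diagonal_indicator_le_one (p : Fin N → Prop) [DecidablePred p] :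
    ‖(Matrix.diagonal fun j : Fin N => if p j then (1 : ℂ) else 0 : Matrix (Fin N) (Fin N) ℂ)‖ ≤ 1 := by
  rw [Matrix.l2_opNorm_diagonal]
  refine (pi_norm_le_iff_of_nonneg zero_le_one).2 fun j => ?_
  split_ifs <;> simp

/-- Entries of `Q·M·P` for coordinate projections `Q = diag 𝟙_p`, `P = diag 𝟙_q`: `𝟙_p(i) 𝟙_q(j) M_{ij}`. -/
theorem diagonal_indicator_mul_mul_diagonal_indicator_apply (M : Matrix (Fin N) (Fin N) ℂ) (p q : Fin N → Prop)
    [DecidablePred p] [DecidablePred q] (i j : Fin N) :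
    ((Matrix.diagonal fun i : Fin N => if p i then (1 : ℂ) else 0) * M *
        (Matrix.diagonal fun j : Fin N => if q j then (1 : ℂ) else 0)) i j =
      if p i ∧ q j then M i j else 0 := by
  rw [Matrix.mul_diagonal, Matrix.mul_apply]
  simp only [Matrix.diagonal_apply, ite_mul, one_mul, zero_mul]
  rw [Finset.sum_ite_eq Finset.univ i]
  simp only [Finset.mem_univ, if_true]
  by_cases hp : p i <;> by_cases hq : q j <;> simp [hp, hq]

/-- A sum over `Fin N` of a function vanishing off `p` is the sum over the subtype `{p}`. -/
theorem sum_ite_eq_sum_subtype (p : Fin N → Prop) [DecidablePred p] (f : Fin N → ℝ) :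
    ∑ i : Fin N, (if p i then f i else 0) = ∑ i : {i : Fin N // p i}, f i := by
  rw [← Finset.sum_filter]
  exact Finset.sum_subtype (p := p) (Finset.univ.filter p) (fun x => by simp) f

/-! ### The linear far-mass bound -/

/-- **A block of a unitary is a contraction, in Frobenius form**: for `U ∈ U(N)` and index predicates `p` (rows) and `q`
(columns), with `A = U.toBlock p q`: `Σ_{i,i'} |(A A†)_{ii'}|² ≤ Σ_{i,j} |A_{ij}|²` (i.e. `‖AA†‖_F² ≤ ‖A‖_op²‖A‖_F² ≤ ‖A‖_F²`). -/
theorem blockGram_sum_norm_sq_le_farMass (U : UN N) (p q : Fin N → Prop) [DecidablePred p] [DecidablePred q] :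
    ∑ i : {i : Fin N // p i}, ∑ i' : {i : Fin N // p i},
        ‖((U : Matrix (Fin N) (Fin N) ℂ).toBlock p q * ((U : Matrix (Fin N) (Fin N) ℂ).toBlock p q)ᴴ) i i'‖ ^ 2 ≤
      ∑ i : {i : Fin N // p i}, ∑ j : {j : Fin N // q j}, ‖(U : Matrix (Fin N) (Fin N) ℂ).toBlock p q i j‖ ^ 2 := by
  set M : Matrix (Fin N) (Fin N) ℂ := (U : Matrix (Fin N) (Fin N) ℂ) with hM
  set Q : Matrix (Fin N) (Fin N) ℂ := Matrix.diagonal fun i : Fin N => if p i then (1 : ℂ) else 0 with hQ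
  set P : Matrix (Fin N) (Fin N) ℂ := Matrix.diagonal fun j : Fin N => if q j then (1 : ℂ) else 0 with hP
  set B : Matrix (Fin N) (Fin N) ℂ := Q * M * P with hB
  have hBapply : ∀ i j, B i j = if p i ∧ q j then M i j else 0 :=
    fun i j => diagonal_indicator_mul_mul_diagonal_indicator_apply M p q i j
  -- operator norm of `B`
  have hBnorm : ‖B‖ ≤ 1 := by
    have hQ1 : ‖Q‖ ≤ 1 := l2_opNorm_diagonal_indicator_le_one p
    have hP1 : ‖P‖ ≤ 1 := l2_opNorm_diagonal_indicator_le_one q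
    have hM1 : ‖M‖ ≤ 1 := by
      rcases Nat.eq_zero_or_pos N with hN | hN
      · subst hN
        have : M = 0 := Subsingleton.elim _ _
        rw [this, norm_zero]; exact zero_le_one
      · haveI : Nonempty (Fin N) := ⟨⟨0, hN⟩⟩
        exact (CStarRing.norm_coe_unitary U).le
    have hQM : ‖Q * M‖ ≤ 1 :=
      (Matrix.l2_opNorm_mul _ _).trans
        ((mul_le_mul hQ1 hM1 (norm_nonneg _) zero_le_one).trans_eq (one_mul 1))
    exact (Matrix.l2_opNorm_mul _ _).trans
      ((mul_le_mul hQM hP1 (norm_nonneg _) zero_le_one).trans_eq (one_mul 1))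
  -- `frobSq (B Bᴴ) ≤ frobSq B`
  have hfrob : frobSq (B * Bᴴ) ≤ frobSq B := by
    have h := frobSq_mul_le' Bᴴ B
    rw [Matrix.l2_opNorm_conjTranspose] at h
    have hsq : ‖B‖ ^ 2 ≤ 1 := by
      have := pow_le_pow_left₀ (norm_nonneg _) hBnorm 2; simpa using this
    calc frobSq (B * Bᴴ) ≤ ‖B‖ ^ 2 * frobSq B := h
      _ ≤ 1 * frobSq B := mul_le_mul_of_nonneg_right hsq (frobSq_nonneg B)
      _ = frobSq B := one_mul _
  -- identify the two sides
  have hright : frobSq B = ∑ i : {i : Fin N // p i}, ∑ j : {j : Fin N // q j}, ‖M.toBlock p q i j‖ ^ 2 := by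
    unfold frobSq
    have h1 : ∀ i : Fin N, ∑ j : Fin N, ‖B i j‖ ^ 2 =
        if p i then ∑ j : {j : Fin N // q j}, ‖M i j‖ ^ 2 else 0 := by
      intro i
      by_cases hp : p i
      · rw [if_pos hp, ← sum_ite_eq_sum_subtype q (fun j => ‖M i j‖ ^ 2)]
        refine Finset.sum_congr rfl fun j _ => ?_
        rw [hBapply]
        by_cases hq : q j
        · simp [hp, hq]
        · simp [hp, hq]
      · rw [if_neg hp]
        refine Finset.sum_eq_zero fun j _ => ?_
        rw [hBapply]; simp [hp]
    simp_rw [h1]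
    rw [sum_ite_eq_sum_subtype p]
    rfl
  have hleft : frobSq (B * Bᴴ) = ∑ i : {i : Fin N // p i}, ∑ i' : {i : Fin N // p i},
      ‖(M.toBlock p q * (M.toBlock p q)ᴴ) i i'‖ ^ 2 := by
    unfold frobSq
    -- entries of `B Bᴴ`
    have hBB : ∀ i i' : Fin N, (B * Bᴴ) i i' =
        if p i ∧ p i' then ∑ j : {j : Fin N // q j}, M i j * star (M i' j) else 0 := by
      intro i i'
      rw [Matrix.mul_apply]
      simp_rw [Matrix.conjTranspose_apply, hBapply]
      by_cases hp : p i
      · by_cases hp' : p i'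
        · rw [if_pos ⟨hp, hp'⟩]
          have : ∀ j : Fin N, (if p i ∧ q j then M i j else 0) * star (if p i' ∧ q j then M i' j else 0) =
              if q j then M i j * star (M i' j) else 0 := by
            intro j; by_cases hq : q j <;> simp [hp, hp', hq]
          simp_rw [this]
          rw [← Finset.sum_filter]
          exact Finset.sum_subtype (p := q) (Finset.univ.filter q) (fun x => by simp) _
        · rw [if_neg (fun h => hp' h.2)]
          refine Finset.sum_eq_zero fun j _ => ?_
          simp [hp']
      · rw [if_neg (fun h => hp h.1)]
        refine Finset.sum_eq_zero fun j _ => ?_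
        simp [hp]
    have hblock : ∀ (i i' : {i : Fin N // p i}), (M.toBlock p q * (M.toBlock p q)ᴴ) i i' =
        ∑ j : {j : Fin N // q j}, M i j * star (M i' j) := by
      intro i i'
      rw [Matrix.mul_apply]
      rfl
    have h1 : ∀ i : Fin N, ∑ i' : Fin N, ‖(B * Bᴴ) i i'‖ ^ 2 =
        if p i then ∑ i' : {i : Fin N // p i}, ‖∑ j : {j : Fin N // q j}, M i j * star (M i' j)‖ ^ 2 else 0 := by
      intro i
      by_cases hp : p i
      · rw [if_pos hp, ← sum_ite_eq_sum_subtype p (fun i' => ‖∑ j : {j : Fin N // q j}, M i j * star (M i' j)‖ ^ 2)]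
        refine Finset.sum_congr rfl fun i' _ => ?_
        rw [hBB]
        by_cases hp' : p i'
        · simp [hp, hp']
        · simp [hp, hp']
      · rw [if_neg hp]
        refine Finset.sum_eq_zero fun i' _ => ?_
        rw [hBB]; simp [hp]
    simp_rw [h1]
    rw [sum_ite_eq_sum_subtype p]
    refine Finset.sum_congr rfl fun i _ => Finset.sum_congr rfl fun i' _ => ?_
    rw [hblock]
  rw [← hleft, ← hright]
  exact hfrob

/-! ### The compression split with the linear bound -/

/-- **Compression of ANY unitary = unitary + low rank + small, with a LINEAR far-mass bound** (S10-A of the LEAD's contract for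
stmt-QuantumFields-27724, window form): for `U ∈ U(N)` and a window/near/far labelling `c : Fin N → Fin 3`:
`U_II = Θ + R + S` with `Θ` unitary, `rank R ≤ #{c = 1}` and `Σ|S_{ij}|² ≤ Σ_{i∈I, c j = 2}|U_{ij}|²` (the far MASS, not its square). -/
theorem compression_eq_unitary_add_lowRank_add_small_linear (U : UN N) (c : Fin N → Fin 3) :
    ∃ Θ R S : Matrix {j : Fin N // c j = 0} {j : Fin N // c j = 0} ℂ,
      Θ ∈ Matrix.unitaryGroup {j : Fin N // c j = 0} ℂ ∧
        R.rank ≤ Fintype.card {j : Fin N // c j = 1} ∧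
          ∑ i, ∑ j, ‖S i j‖ ^ 2 ≤
            ∑ i, ∑ j, ‖(U : Matrix (Fin N) (Fin N) ℂ).toBlock (fun j => c j = 0) (fun j => c j = 2) i j‖ ^ 2 ∧
          (U : Matrix (Fin N) (Fin N) ℂ).toBlock (fun j => c j = 0) (fun j => c j = 0) = Θ + R + S := by
  set M := (U : Matrix (Fin N) (Fin N) ℂ).toBlock (fun j => c j = 0) (fun j => c j = 0) with hM
  set A₁ := (U : Matrix (Fin N) (Fin N) ℂ).toBlock (fun j => c j = 0) (fun j => c j = 1) with hA₁
  set A₂ := (U : Matrix (Fin N) (Fin N) ℂ).toBlock (fun j => c j = 0) (fun j => c j = 2) with hA₂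
  have hsplit : 1 - M * Mᴴ = A₁ * A₁ᴴ + A₂ * A₂ᴴ := by
    have h := one_sub_compression_gram_eq_sum U c 0
    rw [h]
    have huniv : (Finset.univ : Finset (Fin 3)).erase 0 = {1, 2} := by decide
    rw [huniv, Finset.sum_pair (by decide)]
  obtain ⟨Θ, R, S, hΘ, hR, hS, hMeq⟩ := exists_unitary_add_lowRank_add_small_general M (A₁ * A₁ᴴ) (A₂ * A₂ᴴ) hsplit
  exact ⟨Θ, R, S, hΘ, hR.trans (rank_mul_conjTranspose_le_card A₁),
    hS.trans (blockGram_sum_norm_sq_le_farMass U (fun j => c j = 0) (fun j => c j = 2)), hMeq⟩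

end Summit.QuantumFields.YangMills.Theorems.EguchiKawaiDirectionLadder

end
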